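import Summits.AnomalousDissipation.AnomalousDissipation.Theorems.SolenoidalFractalHomogenisationLagrangianCarrierConstructionTowerStepExplicit
import Summits.AnomalousDissipation.AnomalousDissipation.Theorems.SolenoidalFractalHomogenisationLagrangianCarrierConstructionTowerDet
import Summits.AnomalousDissipation.AnomalousDissipation.Theorems.SolenoidalFractalHomogenisationLagrangianCarrierConstructionTowerPeriodic
import Summits.AnomalousDissipation.AnomalousDissipation.Theorems.SolenoidalFractalHomogenisationPermissibleFractalCarrierTime
import Summits.AnomalousDissipation.AnomalousDissipation.Theorems.SolenoidalFractalHomogenisationLagrangianCarrierConstructionFlowsL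
import Literature.Analysis.FluidPDE.AdditiveNoiseMeasurePreserving
import HarnessLib

/-!
# K3L `LagrangianCarrierConstruction` (stmt-AnomalousDissipation-24913), line `birth`, stub `stub_flowsL`: the Lagrangian insertion with
# smooth, volume-preserving and TIME-PERIODIC levels under (W1), (W2) (helper; `--supports stmt-AnomalousDissipation-24913`)

Summits-side helper file (everything proved; no definitions, no named facts). `exists_isLagrangian_periodic` = `…FlowsLVolume.exists_isLagrangian_volume`
plus clause (L4) of `LevelRegular` (time periodicity of every level field, period `refresh 1`) under the window commensurabilities (W1) (every refresh
window of level `m+1` is a whole number of physical periods of that level) and (W2) (nested windows) — two of the three hypotheses of the re-registered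
stub `stub_flowsL`. The tower carries, besides the invariant at all orders and the unit Jacobians, the `refresh 1`-periodicity of the relative flows
(`…TowerPeriodic.tower_step_periodic`): `refresh 1` is a whole number of windows of every level (W2) and a period of every Eulerian level (W1 +
`periodic_level`). NOT a proof of anomalous dissipation (F-D1 is a frontier formal rung).
-/

set_option linter.dupNamespace false

noncomputable section

namespace Summit.AnomalousDissipation.AnomalousDissipation.Theorems.SolenoidalFractalHomogenisation.LagrangianCarrierConstruction

open Set Function Filter Topology Metric MeasureTheory
open scoped NNReal ContDiff
open Literature.Analysis Literature.Analysis.ODE Literature.Analysis.FunctionSpaces Literature.Analysis.FunctionSpaces.Torus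
open Literature.Analysis.FluidPDE Literature.Analysis.FluidPDE.LatticeShear
open Summit.AnomalousDissipation.AnomalousDissipation.Theorems.SolenoidalFractalHomogenisation.PermissibleCarrier (isSmooth_level)

/-- **The Lagrangian insertion with smooth, volume-preserving, TIME-PERIODIC levels** under the window commensurabilities (W1) (windows are
whole fine periods) and (W2) (nested windows): over any such Lagrangian lattice carrier datum there are level fields and Lagrangian displacements
with the same bookkeeping which satisfy `IsLagrangian`, every level field and displacement is `C^∞` in space, the flow maps satisfy `X m s s = id`,
the group law and preserve the volume, and every level field `b (m+1)` is time periodic with period `refresh 1` (clauses (L3a), (F1b), (F2), (L4) of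
`LevelRegular`) (every displacement is the flow of the partial sum of the level fields, in integral form, and every
level is the Eulerian lattice level pushed forward by the coarser flow from each refresh window's left end). Witness: the
Lagrangian tower of the module docstring. [cite: ArmstrongVicol2025, §2.2 (PDF pp. 12, 18: b_m = b_{m−1} + Σ_l 𝟙 v_m(t, X_{m−1}^{-1}(t,x,lτ″_m)); the flows X_m)] -/
theorem exists_isLagrangian_periodic : ∀ k (E : Literature.Analysis.FluidPDE.LatticeShear.LagrangianLatticeCarrier k), (∀ m, ∃ r : ℕ, 0 < r ∧ E.refresh (m + 1) = (r : ℝ) * E.toFractalCarrierData.physPeriod (m + 1)) → (∀ m, ∃ q : ℕ, 0 < q ∧ E.refresh m = (q : ℝ) * E.refresh (m + 1)) → ∃ E' : Literature.Analysis.FluidPDE.LatticeShear.LagrangianLatticeCarrier k, E'.toFractalCarrierData = E.toFractalCarrierData ∧ E'.refresh = E.refresh ∧ E'.θ = E.θ ∧ E'.IsLagrangian ∧ (∀ m t, Torus.IsSmooth (E'.b (m + 1) t)) ∧ (∀ m t s, Torus.IsSmooth (E'.disp m t s)) ∧ (∀ m s, E'.X m s s = id) ∧ (∀ m t s r, E'.X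 m t s ∘ E'.X m s r = E'.X m t r) ∧ (∀ m t s, MeasureTheory.MeasurePreserving (E'.X m t s) volume volume) ∧ (∀ m, Function.Periodic (E'.b (m + 1)) (E.refresh 1)) := by
  intro k E hW1 hW2
  -- the lifted Eulerian level fields and their admissibility
  obtain ⟨v, hv⟩ : ∃ v : ℕ → ℝ → EuclideanSpace ℝ (Fin 3) → EuclideanSpace ℝ (Fin 3),
      ∀ m t z, v m t z = E.toFractalCarrierData.level m t (proj z) := ⟨_, fun _ _ _ => rfl⟩
  have hvU : ∀ m, IsUniformlyLipschitzOn (v m) univ := fun m => by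
    have e : v m = fun t z => E.toFractalCarrierData.level m t (proj z) := funext fun t => funext fun z => hv m t z
    rw [e]; exact isUniformlyLipschitzOn_level_proj _ m
  have hvper : ∀ m t z (n : Fin 3 → ℤ), v m t (z + latticeVec n) = v m t z := fun m t z n => by
    rw [hv, hv, level_proj_add_latticeVec]
  have hvloc : ∀ m (n : ℕ), 1 ≤ n → ∀ r, ∃ ε > 0, ContDiffOn ℝ n (uncurry (v m)) (Icc r (r + ε) ×ˢ univ) ∧
      ContDiffOn ℝ n (uncurry (v m)) (Icc (r - ε) r ×ˢ univ) := fun m n hn r => by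
    have e : v m = fun t z => E.toFractalCarrierData.level m t (proj z) := funext fun t => funext fun z => hv m t z
    rw [e]; exact exists_contDiffOn_slabs_level_proj (n := (n : ℕ∞)) _ m r
  have hvbdd : ∀ m, ∃ C : ℝ, ∀ t z, ‖v m t z‖ ≤ C := fun m =>
    ⟨_, fun t z => by rw [hv]; exact norm_level_proj_le _ m t z⟩
  -- the common period `T = refresh 1`: a whole number of windows of every level, a period of every Eulerian level
  obtain ⟨qf, hqf⟩ : ∃ qf : ℕ → ℕ, ∀ m, E.refresh 1 = (qf m : ℝ) * E.refresh (m + 1) := by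
    have h : ∀ m, ∃ q : ℕ, E.refresh 1 = (q : ℝ) * E.refresh (m + 1) := by
      intro m
      induction m with
      | zero => exact ⟨1, by simp⟩
      | succ n ih =>
        obtain ⟨q, hq⟩ := ih
        obtain ⟨q', -, hq'⟩ := hW2 (n + 1)
        exact ⟨q * q', by rw [hq, hq']; push_cast; ring⟩
    choose qf hqf using h
    exact ⟨qf, hqf⟩
  have hvT : ∀ m t z, v (m + 1) (t + E.refresh 1) z = v (m + 1) t z := by
    intro m t z
    obtain ⟨r, -, hr⟩ := hW1 m
    have hper : Function.Periodic (E.toFractalCarrierData.level (m + 1)) (E.refresh 1) := by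
      rw [hqf m, hr, ← mul_assoc, show ((qf m : ℝ) * (r : ℝ)) = ((qf m * r : ℕ) : ℝ) by push_cast; ring]
      exact (Summit.AnomalousDissipation.AnomalousDissipation.Theorems.SolenoidalFractalHomogenisation.PermissibleCarrier.periodic_level
        E.toFractalCarrierData (m + 1)).nat_mul _
    rw [hv, hv, hper t]
  -- the tower invariant
  let INV : (ℝ → EuclideanSpace ℝ (Fin 3) ≃ EuclideanSpace ℝ (Fin 3)) → (ℝ → EuclideanSpace ℝ (Fin 3) → EuclideanSpace ℝ (Fin 3)) →
      Set ℝ → Prop := fun A B D =>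
    (∀ t z (n : Fin 3 → ℤ), A t (z + latticeVec n) = A t z + latticeVec n) ∧
    (∀ (n : ℕ), 1 ≤ n → ∀ r, ∃ ε > 0, ContDiffOn ℝ n (fun p : ℝ × EuclideanSpace ℝ (Fin 3) => A p.1 p.2) (Icc r (r + ε) ×ˢ univ) ∧
      ContDiffOn ℝ n (fun p : ℝ × EuclideanSpace ℝ (Fin 3) => A p.1 p.2) (Icc (r - ε) r ×ˢ univ)) ∧
    (∀ (n : ℕ), 1 ≤ n → ∀ r, ∃ ε > 0, ContDiffOn ℝ n (fun p : ℝ × EuclideanSpace ℝ (Fin 3) => (A p.1).symm p.2) (Icc r (r + ε) ×ˢ univ) ∧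
      ContDiffOn ℝ n (fun p : ℝ × EuclideanSpace ℝ (Fin 3) => (A p.1).symm p.2) (Icc (r - ε) r ×ˢ univ)) ∧
    D.Countable ∧
    (∀ (n : ℕ), 1 ≤ n → ∀ t ∉ D, ∃ ε > 0, ContDiffOn ℝ n (fun p : ℝ × EuclideanSpace ℝ (Fin 3) => A p.1 p.2) (Icc (t - ε) (t + ε) ×ˢ univ)) ∧
    (∀ (n : ℕ), 1 ≤ n → ∀ t ∉ D, ∃ ε > 0, ContDiffOn ℝ n (fun p : ℝ × EuclideanSpace ℝ (Fin 3) => (A p.1).symm p.2)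
      (Icc (t - ε) (t + ε) ×ˢ univ)) ∧
    (∀ t ∉ D, ∀ z, HasDerivAt (fun τ => A τ z) (B t (A t z)) t) ∧
    (∀ t z (n : Fin 3 → ℤ), B t (z + latticeVec n) = B t z) ∧
    (∀ a b : ℝ, ∃ C : ℝ, ∀ t ∈ Icc a b, ∀ z, ‖B t z‖ ≤ C) ∧
    (∀ t ∉ D, ∀ z, ContinuousAt (uncurry B) (t, z)) ∧
    (∀ a b : ℝ, ∃ K : ℝ, ∀ t ∈ Icc a b, ∀ z, ‖fderiv ℝ (A t) z‖ ≤ K) ∧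
    (∀ a b : ℝ, ∃ K : ℝ, ∀ t ∈ Icc a b, ∀ z, ‖fderiv ℝ (fun y => (A t).symm y) z‖ ≤ K)
  let DET : (ℝ → EuclideanSpace ℝ (Fin 3) ≃ EuclideanSpace ℝ (Fin 3)) → Prop := fun A =>
    (∀ t, (∀ z, (fderiv ℝ (A t) z).det = 1) ∧ ∀ z, (fderiv ℝ (A t).symm z).det = 1) ∧
    ∀ t s z, A (t + E.refresh 1) ((A (s + E.refresh 1)).symm z) = A t ((A s).symm z)
  -- the inserted velocity of level `m+1` over a coarse flow `A`
  let INS : ℕ → (ℝ → EuclideanSpace ℝ (Fin 3) ≃ EuclideanSpace ℝ (Fin 3)) → ℝ → EuclideanSpace ℝ (Fin 3) →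
      EuclideanSpace ℝ (Fin 3) := fun m A t z =>
    fderiv ℝ (fun y => A t ((A ((⌊t / E.refresh (m + 1)⌋ : ℝ) * E.refresh (m + 1))).symm y))
      (A ((⌊t / E.refresh (m + 1)⌋ : ℝ) * E.refresh (m + 1)) ((A t).symm z))
      (v (m + 1) t (A ((⌊t / E.refresh (m + 1)⌋ : ℝ) * E.refresh (m + 1)) ((A t).symm z)))
  have base : INV (fun _ => Equiv.refl _) (fun _ _ => 0) ∅ := by
    refine ⟨fun t z n => rfl, fun n _ r => ⟨1, one_pos, contDiff_snd.contDiffOn, contDiff_snd.contDiffOn⟩,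
      fun n _ r => ⟨1, one_pos, contDiff_snd.contDiffOn, contDiff_snd.contDiffOn⟩, countable_empty,
      fun n _ t _ => ⟨1, one_pos, contDiff_snd.contDiffOn⟩, fun n _ t _ => ⟨1, one_pos, contDiff_snd.contDiffOn⟩,
      fun t _ z => by simpa using hasDerivAt_const t z, fun t z n => rfl, fun a b => ⟨0, fun t _ z => by simp⟩,
      fun t _ z => continuous_const.continuousAt, fun a b => ⟨1, fun t _ z => ?_⟩, fun a b => ⟨1, fun t _ z => ?_⟩⟩
    · simp only [Equiv.coe_refl, fderiv_id]; exact ContinuousLinearMap.norm_id_le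
    · simp only [Equiv.refl_symm, Equiv.coe_refl]
      rw [show (fun y : EuclideanSpace ℝ (Fin 3) => id y) = id from rfl, fderiv_id]; exact ContinuousLinearMap.norm_id_le
  have base' : DET (fun _ => Equiv.refl _) := by
    refine ⟨fun t => ?_, fun t s z => rfl⟩
    constructor <;> intro z <;> simp [ContinuousLinearMap.det]
  -- Liouville for the Eulerian levels
  have hZdet : ∀ m s t (y : EuclideanSpace ℝ (Fin 3)), (fderiv ℝ (evolutionMap (v m) s t) y).det = 1 := fun m s t y => by
    have e : v m = fun t z => E.toFractalCarrierData.level m t (proj z) := funext fun t => funext fun z => hv m t z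
    rw [e]; exact det_fderiv_evolutionMap_level _ m s t y
  have step : ∀ m A B D, INV A B D → DET A → ∃ A' D', INV A' (fun t z => B t z + INS m A t z) D' ∧ DET A' := by
    intro m A B D h hdet'
    obtain ⟨hdet, hper⟩ := hdet'
    obtain ⟨i1, i3, i3', i4, i4a, i4b, i5, i7a, i7b, i7c, i8, i8'⟩ := h
    obtain ⟨Z, hZ, hZ'⟩ := exists_flowEquiv (hvU (m + 1))
    obtain ⟨C, hC0, hC⟩ := exists_int_chain fun j : ℤ => (Z (((j : ℝ) + 1) * E.refresh (m + 1)) ((j : ℝ) * E.refresh (m + 1))).trans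
      ((A ((j : ℝ) * E.refresh (m + 1))).symm.trans (A (((j : ℝ) + 1) * E.refresh (m + 1))))
    refine ⟨_, _, tower_step_explicit A B D i1 i3 i3' i4 i4a i4b i5 i7a i7b i7c i8 i8' (v (m + 1)) (hvU _) (hvper _) (hvloc _)
      (hvbdd _) (E.refresh (m + 1)) (E.refresh_pos _) Z hZ hZ' C hC0 hC _ (fun t => rfl) _ rfl, ?_⟩
    -- unit Jacobians of the next flow
    have hA1 : ∀ t, ContDiff ℝ 1 (A t) ∧ ContDiff ℝ 1 (A t).symm := fun t => by
      obtain ⟨ε, hε, hR1, -⟩ := i3 1 le_rfl t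
      obtain ⟨ε', hε', hR2, -⟩ := i3' 1 le_rfl t
      exact ⟨hR1.comp_contDiff (contDiff_const.prodMk contDiff_id) fun _ => ⟨⟨le_rfl, by linarith⟩, mem_univ _⟩,
        hR2.comp_contDiff (contDiff_const.prodMk contDiff_id) fun _ => ⟨⟨le_rfl, by linarith⟩, mem_univ _⟩⟩
    have hZ1 : ∀ t s, ContDiff ℝ 1 (Z t s) ∧ ContDiff ℝ 1 (Z t s).symm := fun t s => by
      constructor
      · have e : ⇑(Z t s) = evolutionMap (v (m + 1)) s t := funext fun z => hZ t s z
        rw [e]; exact contDiff_evolutionMap_of_local (hvU _) le_rfl (hvloc _ 1 le_rfl) s t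
      · have e : ⇑(Z t s).symm = evolutionMap (v (m + 1)) t s := funext fun z => hZ' t s z
        rw [e]; exact contDiff_evolutionMap_of_local (hvU _) le_rfl (hvloc _ 1 le_rfl) t s
    have hZd : ∀ t s, (∀ z, (fderiv ℝ (Z t s) z).det = 1) ∧ ∀ z, (fderiv ℝ (Z t s).symm z).det = 1 := fun t s => by
      constructor
      · intro z
        have e : ⇑(Z t s) = evolutionMap (v (m + 1)) s t := funext fun z => hZ t s z
        rw [e]; exact hZdet _ _ _ _
      · intro z
        have e : ⇑(Z t s).symm = evolutionMap (v (m + 1)) t s := funext fun z => hZ' t s z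
        rw [e]; exact hZdet _ _ _ _
    have hCd := det_chain C _ hC0 hC (fun j => contDiff_trans (hZ1 _ _) (contDiff_trans (contDiff_symm (hA1 _)) (hA1 _)))
      (fun j => det_trans (hZ1 _ _) (contDiff_trans (contDiff_symm (hA1 _)) (hA1 _)) (hZd _ _)
        (det_trans (contDiff_symm (hA1 _)) (hA1 _) (det_symm (hdet _)) (hdet _)))
    have hCc1 := contDiff_chain C _ hC0 hC fun j => contDiff_trans (hZ1 _ _) (contDiff_trans (contDiff_symm (hA1 _)) (hA1 _))
    refine ⟨fun t => det_window_formula A Z (C ⌊t / E.refresh (m + 1)⌋) hA1 hZ1 (hCc1 _) hdet hZd (hCd _) t _, ?_⟩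
    exact (tower_step_periodic A (v (m + 1)) (hvU _) (E.refresh_pos (m + 1)) (hqf m) hper (hvT m) Z hZ hZ' C hC0 hC _
      (fun t => rfl)).1
  -- the tower
  obtain ⟨A, Bs, Ds, hB0, hBsucc, hINV, hDET⟩ : ∃ (A : ℕ → ℝ → EuclideanSpace ℝ (Fin 3) ≃ EuclideanSpace ℝ (Fin 3))
      (Bs : ℕ → ℝ → EuclideanSpace ℝ (Fin 3) → EuclideanSpace ℝ (Fin 3)) (Ds : ℕ → Set ℝ),
      Bs 0 = (fun _ _ => 0) ∧ (∀ m, Bs (m + 1) = fun t z => Bs m t z + INS m (A m) t z) ∧ (∀ m, INV (A m) (Bs m) (Ds m)) ∧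
      ∀ m, DET (A m) := by
    let T : ℕ → {p : (ℝ → EuclideanSpace ℝ (Fin 3) ≃ EuclideanSpace ℝ (Fin 3)) ×
        (ℝ → EuclideanSpace ℝ (Fin 3) → EuclideanSpace ℝ (Fin 3)) × Set ℝ // INV p.1 p.2.1 p.2.2 ∧ DET p.1} :=
      fun m => Nat.rec ⟨(fun _ => Equiv.refl _, fun _ _ => 0, ∅), base, base'⟩
        (fun m T => ⟨((step m T.1.1 T.1.2.1 T.1.2.2 T.2.1 T.2.2).choose, fun t z => T.1.2.1 t z + INS m T.1.1 t z,
          (step m T.1.1 T.1.2.1 T.1.2.2 T.2.1 T.2.2).choose_spec.choose),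
          (step m T.1.1 T.1.2.1 T.1.2.2 T.2.1 T.2.2).choose_spec.choose_spec⟩) m
    exact ⟨fun m => (T m).1.1, fun m => (T m).1.2.1, fun m => (T m).1.2.2, rfl, fun m => rfl, fun m => (T m).2.1,
      fun m => (T m).2.2⟩
  -- the level fields and displacements on the torus
  obtain ⟨bf, hb0, hbS⟩ : ∃ bf : ℕ → ℝ → UnitAddTorus (Fin 3) → EuclideanSpace ℝ (Fin 3),
      (∀ t x, bf 0 t x = 0) ∧ ∀ m t x, bf (m + 1) t x = INS m (A m) t (repr x) :=
    ⟨fun m t x => match m with | 0 => 0 | m + 1 => INS m (A m) t (repr x), fun _ _ => rfl, fun _ _ _ => rfl⟩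
  obtain ⟨dsp, hdsp⟩ : ∃ dsp : ℕ → ℝ → ℝ → UnitAddTorus (Fin 3) → EuclideanSpace ℝ (Fin 3),
      ∀ m t s x, dsp m t s x = A m t ((A m s).symm (repr x)) - repr x := ⟨_, fun _ _ _ _ => rfl⟩
  -- the partial sums of the level fields are the tower velocities
  have hsum : ∀ m t z, ∑ i ∈ Finset.range m, bf (i + 1) t (proj z) = Bs m t z := by
    intro m
    induction m with
    | zero => intro t z; simp [hB0]
    | succ n ih =>
      intro t z
      rw [Finset.sum_range_succ, ih, hBsucc, hbS]
      -- periodicity of the inserted velocity through `repr ∘ proj`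
      have hper : ∀ y (k' : Fin 3 → ℤ), INS n (A n) t (y + latticeVec k') = INS n (A n) t y := fun y k' =>
        inserted_add_latticeVec (A n) (v (n + 1)) t _ (hINV n).1 (hvper _) y k'
      simp only []
      rw [periodic_repr_proj hper]
  -- smoothness of the tower at all orders
  have hAinf : ∀ m t, ContDiff ℝ ∞ (A m t) ∧ ContDiff ℝ ∞ (A m t).symm := fun m t => by
    obtain ⟨-, i3, i3', -, -, -, -, -, -, -, -, -⟩ := hINV m
    constructor
    · refine contDiff_infty.2 fun n => ?_
      obtain ⟨ε, hε, hR1, -⟩ := i3 (max n 1) (le_max_right _ _) t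
      have h := hR1.comp_contDiff (contDiff_const.prodMk contDiff_id) fun _ => ⟨⟨le_rfl, by linarith⟩, mem_univ _⟩
      exact h.of_le (by exact_mod_cast le_max_left n 1)
    · refine contDiff_infty.2 fun n => ?_
      obtain ⟨ε, hε, hR1, -⟩ := i3' (max n 1) (le_max_right _ _) t
      have h := hR1.comp_contDiff (contDiff_const.prodMk contDiff_id) fun _ => ⟨⟨le_rfl, by linarith⟩, mem_univ _⟩
      exact h.of_le (by exact_mod_cast le_max_left n 1)
  have hXeqm : ∀ m t s z (k' : Fin 3 → ℤ), A m t ((A m s).symm (z + latticeVec k')) = A m t ((A m s).symm z) + latticeVec k' :=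
    fun m t s z k' => by rw [equivariant_symm ((hINV m).1 s), (hINV m).1]
  refine ⟨⟨E.toFractalCarrierData, E.refresh, E.θ, bf, dsp, E.refresh_pos, E.θ_pos⟩, rfl, rfl, rfl, fun m => ⟨?_, ?_⟩,
    fun m t => ?_, fun m t s => ?_, fun m s => ?_, fun m t s r => ?_, fun m t s => ?_, fun m t => ?_⟩
  · -- `IsFlow m`: the integral form of the flow equation of `A m`
    intro t s x
    obtain ⟨i1, i3, -, i4, -, -, i5, i7a, i7b, i7c, -, -⟩ := hINV m
    have i3₁ := i3 1 le_rfl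
    set z₀ : EuclideanSpace ℝ (Fin 3) := (A m s).symm (repr x) with hz₀
    show dsp m t s x = ∫ r in s..t, ∑ i ∈ Finset.range m, bf (i + 1) r (x + proj (dsp m r s x))
    have hX : ∀ r, x + proj (dsp m r s x) = proj (A m r z₀) := fun r => by
      rw [hdsp]; exact add_proj_disp_eq (fun y => A m r ((A m s).symm y)) x
    simp only [hX, hsum]
    have hcontA : Continuous fun r => A m r z₀ := continuous_apply_of_slabs (A m) i3₁ z₀
    have hcont : Continuous fun r => A m r z₀ - repr x := hcontA.sub continuous_const
    have hderiv : ∀ r ∉ Ds m, HasDerivAt (fun r => A m r z₀ - repr x) (Bs m r (A m r z₀)) r :=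
      fun r hr => (i5 r hr z₀).sub_const _
    have hint : ∀ a b : ℝ, IntervalIntegrable (fun r => Bs m r (A m r z₀)) volume a b := by
      refine intervalIntegrable_of_bounded_of_continuousAt_off_countable i4 (fun r hr => ?_) (fun a b => ?_)
      · exact ContinuousAt.comp_of_eq (i7c r hr (A m r z₀)) (continuous_id.prodMk hcontA).continuousAt rfl
      · obtain ⟨C, hC⟩ := i7b a b
        exact ⟨C, fun r hr => hC r hr _⟩
    rw [integral_eq_sub_of_hasDerivAt_off_countable i4 hcont hderiv hint s t, hdsp]
    have hFs : A m s z₀ = repr x := by rw [hz₀]; exact Equiv.apply_symm_apply _ _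
    rw [hFs, sub_self, sub_zero]
  · -- `IsInserted m`: the level `m+1` field is the pushed-forward Eulerian level, window by window
    intro j t ht y
    obtain ⟨i1, -, -, -, -, -, -, -, -, -, -, -⟩ := hINV m
    have hAc : ∀ τ, ContDiff ℝ 1 (A m τ) ∧ ContDiff ℝ 1 (A m τ).symm := fun τ =>
      ⟨(hAinf m τ).1.of_le (by exact_mod_cast le_top), (hAinf m τ).2.of_le (by exact_mod_cast le_top)⟩
    set s : ℝ := (j : ℝ) * E.refresh (m + 1) with hs
    -- the frame: equivariance and smoothness of `X(t, s) = A t ∘ (A s)⁻¹`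
    have hXeq : ∀ z (k' : Fin 3 → ℤ), A m t ((A m s).symm (z + latticeVec k')) = A m t ((A m s).symm z) + latticeVec k' :=
      fun z k' => by rw [equivariant_symm (i1 s), i1]
    have hXd : Differentiable ℝ fun z => A m t ((A m s).symm z) :=
      ((hAc t).1.comp (hAc s).2).differentiable (by simp)
    show bf (m + 1) t (y + proj (dsp m t s y)) =
      (ContinuousLinearMap.id ℝ (EuclideanSpace ℝ (Fin 3)) + fderiv ℝ (Torus.lift (dsp m t s)) (repr y))
        (E.toFractalCarrierData.level (m + 1) t y)
    -- left-hand side: the inserted velocity at the pushed point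
    have hX : y + proj (dsp m t s y) = proj (A m t ((A m s).symm (repr y))) := by
      rw [hdsp]; exact add_proj_disp_eq (fun y' => A m t ((A m s).symm y')) y
    have hper : ∀ z (k' : Fin 3 → ℤ), INS m (A m) t (z + latticeVec k') = INS m (A m) t z := fun z k' =>
      inserted_add_latticeVec (A m) (v (m + 1)) t _ i1 (hvper _) z k'
    have hfl : ⌊t / E.refresh (m + 1)⌋ = j := floor_eq_of_mem_Ico (E.refresh_pos _) ht
    rw [hX, hbS, periodic_repr_proj hper]
    simp only [INS, hfl, ← hs, Equiv.symm_apply_apply, Equiv.apply_symm_apply, hv, proj_repr]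
    -- right-hand side: the derivative of the lifted displacement
    have hl : Torus.lift (dsp m t s) = fun z => A m t ((A m s).symm z) - z := by
      funext z
      have e : dsp m t s = fun x => (fun y' => A m t ((A m s).symm y')) (repr x) - repr x := funext fun x => hdsp m t s x
      rw [e]
      exact lift_disp_eq (F := fun y' => A m t ((A m s).symm y')) hXeq z
    have hF : HasFDerivAt (fun z => A m t ((A m s).symm z) - z)
        (fderiv ℝ (fun y' => A m t ((A m s).symm y')) (repr y) - ContinuousLinearMap.id ℝ (EuclideanSpace ℝ (Fin 3)))
        (repr y) := ((hXd _).hasFDerivAt).sub (hasFDerivAt_id _)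
    rw [hl, hF.fderiv]
    simp

  · -- (L3a) every level field is smooth in space
    show ContDiff ℝ ∞ (Torus.lift (bf (m + 1) t))
    have hper : ∀ z (k' : Fin 3 → ℤ), INS m (A m) t (z + latticeVec k') = INS m (A m) t z := fun z k' =>
      inserted_add_latticeVec (A m) (v (m + 1)) t _ (hINV m).1 (hvper _) z k'
    have hl : Torus.lift (bf (m + 1) t) = INS m (A m) t := by
      funext z; rw [Torus.lift_apply, hbS, periodic_repr_proj hper]
    rw [hl]
    set w : ℝ := (⌊t / E.refresh (m + 1)⌋ : ℝ) * E.refresh (m + 1) with hw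
    have hF : ContDiff ℝ ∞ fun y => A m t ((A m w).symm y) := (hAinf m t).1.comp (hAinf m w).2
    have hq : ContDiff ℝ ∞ fun z => A m w ((A m t).symm z) := (hAinf m w).1.comp (hAinf m t).2
    have hvs : ContDiff ℝ ∞ fun y => v (m + 1) t y := by
      have e : (fun y => v (m + 1) t y) = Torus.lift (E.toFractalCarrierData.level (m + 1) t) :=
        funext fun y => by rw [hv, Torus.lift_apply]
      rw [e]; exact isSmooth_level _ _ _
    have hD : ContDiff ℝ ∞ fun p : EuclideanSpace ℝ (Fin 3) × EuclideanSpace ℝ (Fin 3) =>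
        fderiv ℝ (fun y => A m t ((A m w).symm y)) p.1 p.2 := hF.contDiff_fderiv_apply (by simp)
    exact hD.comp (hq.prodMk (hvs.comp hq))
  · -- (F1b) every displacement is smooth in space
    show ContDiff ℝ ∞ (Torus.lift (dsp m t s))
    have hl : Torus.lift (dsp m t s) = fun z => A m t ((A m s).symm z) - z := by
      funext z
      have e : dsp m t s = fun x => (fun y' => A m t ((A m s).symm y')) (repr x) - repr x := funext fun x => hdsp m t s x
      rw [e]
      exact lift_disp_eq (F := fun y' => A m t ((A m s).symm y')) (hXeqm m t s) z
    rw [hl]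
    exact ((hAinf m t).1.comp (hAinf m s).2).sub contDiff_id
  · -- (F2a) `X m s s = id`
    funext x
    show x + proj (dsp m s s x) = x
    rw [hdsp, add_proj_disp_eq (fun y' => A m s ((A m s).symm y')) x]
    simp only [Equiv.apply_symm_apply, proj_repr]
  · -- (F2b) the two-parameter group law
    funext x
    show (x + proj (dsp m s r x)) + proj (dsp m t s (x + proj (dsp m s r x))) = x + proj (dsp m t r x)
    rw [hdsp m s r, add_proj_disp_eq (fun y' => A m s ((A m r).symm y')) x]
    rw [hdsp m t s, add_proj_disp_eq (fun y' => A m t ((A m s).symm y')) _]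
    rw [hdsp m t r, add_proj_disp_eq (fun y' => A m t ((A m r).symm y')) x]
    obtain ⟨k', hk'⟩ := exists_repr_proj_eq_add_latticeVec_holds (A m s ((A m r).symm (repr x)))
    rw [hk', hXeqm m t s, Torus.proj_add_latticeVec]
    simp

  · -- (F2c) the flow maps preserve the volume of the torus (Liouville)
    have hAc : ContDiff ℝ 1 (A m t) ∧ ContDiff ℝ 1 (A m s).symm :=
      ⟨(hAinf m t).1.of_le (by exact_mod_cast le_top), (hAinf m s).2.of_le (by exact_mod_cast le_top)⟩
    have hX1 : ContDiff ℝ 1 fun z => A m t ((A m s).symm z) := hAc.1.comp hAc.2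
    refine Literature.Analysis.FluidPDE.Torus.measurePreserving_of_equivariant_det_one
      (X := fun z => A m t ((A m s).symm z)) (X' := fun y => fderiv ℝ (fun z => A m t ((A m s).symm z)) y)
      (fun y => ((hX1.differentiable (by simp)) y).hasFDerivAt) (fun y => ?_) ((A m s).symm.trans (A m t)).bijective
      (hXeqm m t s) ?_ (fun y => ?_)
    · rw [det_fderiv_comp hAc.1 hAc.2, ((hDET m).1 t).1, ((hDET m).1 s).2, mul_one]
    · -- measurability: the torus map is continuous
      have hl : Torus.lift (dsp m t s) = fun z => A m t ((A m s).symm z) - z := by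
        funext z
        have e : dsp m t s = fun x => (fun y' => A m t ((A m s).symm y')) (repr x) - repr x := funext fun x => hdsp m t s x
        rw [e]
        exact lift_disp_eq (F := fun y' => A m t ((A m s).symm y')) (hXeqm m t s) z
      have hc : Continuous (dsp m t s) := by
        rw [← Torus.continuous_lift_iff, hl]
        exact hX1.continuous.sub continuous_id
      have hX : Continuous fun x : UnitAddTorus (Fin 3) => x + proj (dsp m t s x) :=
        continuous_id.add (Torus.continuous_proj.comp hc)
      exact hX.measurable
    · show proj y + proj (dsp m t s (proj y)) = proj (A m t ((A m s).symm y))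
      rw [hdsp, add_proj_disp_eq (fun y' => A m t ((A m s).symm y')) (proj y)]
      obtain ⟨k', hk'⟩ := exists_repr_proj_eq_add_latticeVec_holds y
      rw [hk', hXeqm m t s, Torus.proj_add_latticeVec]

  · -- (L4) every level field is time periodic with period `refresh 1`
    funext x
    show bf (m + 1) (t + E.refresh 1) x = bf (m + 1) t x
    rw [hbS, hbS]
    obtain ⟨Z, hZ, hZ'⟩ := exists_flowEquiv (hvU (m + 1))
    obtain ⟨C, hC0, hC⟩ := exists_int_chain fun j : ℤ => (Z (((j : ℝ) + 1) * E.refresh (m + 1)) ((j : ℝ) * E.refresh (m + 1))).trans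
      ((A m ((j : ℝ) * E.refresh (m + 1))).symm.trans (A m (((j : ℝ) + 1) * E.refresh (m + 1))))
    exact (tower_step_periodic (A m) (v (m + 1)) (hvU _) (E.refresh_pos (m + 1)) (hqf m) (hDET m).2 (hvT m) Z hZ hZ' C hC0 hC _
      (fun t => rfl)).2 t (repr x)

end Summit.AnomalousDissipation.AnomalousDissipation.Theorems.SolenoidalFractalHomogenisation.LagrangianCarrierConstruction

end
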